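import Summits.CriticalPhenomena.PercolationContinuityZ3.Theorems.PercNearOneGluingNoHeavyLowerTailSahiPair43CheckPacked

/-!
# `NoHeavyLowerTail` (crux stmt-CriticalPhenomena-4575), Sahi programme: the cell `(4,3)` — pair-saturation check, **chunk 5 of 20**

Support file (Sahi cell `prim-sahi`, seat `prim-sahi-typer` gen 32; `--supports stmt-CriticalPhenomena-4575`, COMPUTATIONAL).
One `native_decide` evaluation of the checker `chunkCheck` of `…SahiPair43CheckPacked` (all antichains of `[3]^4` whose node hash is
`≡ 5 (mod 20)`: every admissible 2-colouring's y-profile passes the packed downward-transport test).  The soundness theorem turning the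
20 chunks into `SahiGridPattern.PatternPos 4` lives in the companion link files; nothing is asserted here beyond the Boolean evaluation.
Farm timing of one chunk ≈ 300 s. [this work] [computational]
-/

namespace Summit.CriticalPhenomena.PercolationContinuityZ3.Theorems.SahiGridPattern.Pair43

/-- **Chunk 5 of 20** of the pair-saturation check on `[3]^4` passes (`native_decide`). [this work] [computational] -/
theorem chunkCheck_20_5 : chunkCheck 20 5 = true := by native_decide

end Summit.CriticalPhenomena.PercolationContinuityZ3.Theorems.SahiGridPattern.Pair43
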